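/-
Copyright (c) 2026 the pub-hodgecm-mathlib formalisation cell (harness21).  Prover seat hodgecm-mathlib-K2Liu-p05 (g6), Track B «K2-LIT»,
#184♮ = hLiu418 = `stmt-HodgeConjecture-24832`; #42S organ S2, S2-asm road (γ): the (der) CUT file D1 (`K2/K2Liu-p05/g6/CUT-der-instance.K2Liu-p05-g6.md`
7ac655e69c8f80a2; LEAD F0P6-plan (g14) BATCH #41∕#45; consumer K2Liu-p25 (g0) D2 `K2LiuArchSWSystemDerivative` 📤 p861276, binder `hcurve` BY VALUE).
-/
import Summits.HodgeConjecture.HodgeConjecture.Theorems.K2LiuArchSWValueFockDerivativeUniform   -- ★ (r-b)-uniform p860738's currency (`uFormGroup`, `expMem`, `archEmb`)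
import Summits.HodgeConjecture.HodgeConjecture.Theorems.K2LiuArchTubeCurveAlgebra                -- ★ p861184 (C1)(C2): `update_mul_eq_update_mul_mulSingle`
import Summits.HodgeConjecture.HodgeConjecture.Theorems.K2LiuLieRayDifferentiability             -- ★ `conjTranspose_exp_mul_J_mul_exp`
import Summits.HodgeConjecture.HodgeConjecture.Theorems.K2LiuArchOneParameterOrbitDefs            -- ★ `archEmb`, `archEmb_eq_archToAdelic`
import HarnessLib

/-!
# Crux `HLiu418`, S2-asm road (γ), (der) D1: THE CURVE LETTER `hcurve` OF D2 FROM TWO FRAME LETTERS —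
# (F1) the tube chart is multiplicative on `U(J)`, (F2′) its one-parameter subgroups are those of the place homomorphism `ψ`

Cell `hodgecm-mathlib`, crux item hLiu418 = `stmt-HodgeConjecture-24832`; squad K2 ∕ K2Liu; S2 desk ∕ prover K2Liu-p05 (g6).
THEOREMS ONLY (no `def`, no `instance`, no notation, no named-fact hypothesis, no `sorry`); lane `--supports stmt-HodgeConjecture-24832 --as helper`.

K2Liu-p25 (g0)'s D2 `K2LiuArchSWSystemDerivative.derivClause_archSWValue_hermite` (📤 p861276) takes ONE curve letter `hcurve` BY VALUE:
`∀ X = C(αβγδ)C′ ∈ 𝔲(J), ∃ Y′ ∈ 𝔲(2,2), ∀ y u (unitary) s, archToAdelic (archPiEquivCM⁻¹ (y[w ↦ ιw (k_u · exp (sX))])) = archEmb (archPiEquivCM⁻¹ (y[w ↦ ιw k_u])) · archEmb (ψ (exp (sY′)))`.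
This file proves it from the two FRAME LETTERS of the tube chart `ιw : M₄(ℂ) → archLocal w` (K2E5-p16 (g7)'s frame block):
(F1) `ιw (g h) = ιw g · ιw h` for `g, h ∈ U(J)`;  (F2′) for every `X ∈ 𝔲(J)` some `Y′ ∈ 𝔲(2,2)` has `archPiEquivCM⁻¹ (δ_w (ιw (exp (sX)))) = ψ (exp (sY′))` for all `s`
(the one-parameter-subgroup shadow of the general-`g` chart∕`placeSec` relation (F2)).  Proof = peel the frozen tuple (★ p861184 `update_mul_eq_update_mul_mulSingle`; `k_u`,
`exp (sX) ∈ U(J)` by ★ `kU_mem_UJ`, ★ `conjTranspose_exp_mul_J_mul_exp`), two `map_mul`, (F2′), and ★ `archEmb_eq_archToAdelic` (`rfl`).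
* **`hcurve_of_frame`** — the curve letter in D2's bytes VERBATIM.
References: [KudlaRallis1994] §1; [Knapp1986] Ch. VI §2; [BorelJacquet1979] §4.1.
HONEST LABEL.  Count-neutral helper: `HC_CM` is proved only modulo the 7 printed citations (2 remaining named inputs: hLiu418 = `stmt-HodgeConjecture-24832`,
h413 = `stmt-HodgeConjecture-24833`) until rung 0 closes; this file closes no socket.
-/

set_option autoImplicit false
set_option linter.dupNamespace false -- the mandated namespace repeats `HodgeConjecture.HodgeConjecture`

noncomputable section

attribute [local instance 100] LieRing.ofAssociativeRing -- the Mathlib idiom naming `𝔲(2,2) = (uFormGroup (Fin 2) (Fin 2)).lie` (exactly as ★ p860738)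

open scoped Classical Matrix MatrixGroups
open Complex (I)
open Matrix (fromBlocks)
open NumberField NumberField.InfinitePlace NumberField.mixedEmbedding IsDedekindDomain
open Literature.NumberTheory.Automorphic Literature.NumberTheory.Automorphic.UnitaryGroup Literature.NumberTheory.GaloisRepresentations
open Literature.RepresentationTheory.KonnoKonno2007 Literature.RepresentationTheory.KonnoKonno2007.RealDualPair
open Literature.NumberTheory.GelbartRogawski1991 Literature.NumberTheory.GelbartRogawski1991.GRConstruction
open Literature.NumberTheory.GelbartRogawski1991.UnitaryDualPair
open Summit.HodgeConjecture.HodgeConjecture.Cruxes.HLiu418 (K2LiuArchOneParameterOrbitDefs.archEmb K2LiuArchOneParameterOrbitDefs.archEmb_eq_archToAdelic)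
open Summit.HodgeConjecture.HodgeConjecture.Cruxes.HLiu418.K2LiuArchTubeCurveAlgebra
open Summit.HodgeConjecture.HodgeConjecture.Cruxes.HLiu418.K2LiuU22ShilovCoordinate (kU_mem_UJ)
open Summit.HodgeConjecture.HodgeConjecture.Cruxes.HLiu418.K2LiuLieRayDifferentiability (conjTranspose_exp_mul_J_mul_exp)

namespace Summit.HodgeConjecture.HodgeConjecture.Cruxes.HLiu418.K2LiuArchTubeCurveReading

variable (L : Type) [Field L] [NumberField L] [IsCMField L]
variable {N M n : ℕ} (e : Fin N × Fin M ≃ Fin n)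
  (dV : Fin N → L) (hdV : ∀ i, IsCMField.complexConj L (dV i) = dV i)
  (dW : Fin M → L) (hdW : ∀ i, IsCMField.complexConj L (dW i) = dW i)

/-- **THE CURVE LETTER `hcurve` OF D2, FROM THE FRAME LETTERS (F1)(F2′)** (D2's binder bytes verbatim). [cite: KudlaRallis1994, §1] [cite: Knapp1986, Ch. VI §2] -/
theorem hcurve_of_frame (w : {w : InfinitePlace L // w.IsComplex}) (ιw : Matrix (Fin 2 ⊕ Fin 2) (Fin 2 ⊕ Fin 2) ℂ → UnitaryGroup.archLocal L (n + n) (hermD L e dV hdV dW hdW) w)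
    (hιmul : ∀ g h : Matrix (Fin 2 ⊕ Fin 2) (Fin 2 ⊕ Fin 2) ℂ, gᴴ * Matrix.J (Fin 2) ℂ * g = Matrix.J (Fin 2) ℂ → hᴴ * Matrix.J (Fin 2) ℂ * h = Matrix.J (Fin 2) ℂ → ιw (g * h) = ιw g * ιw h)
    (ψ : UForm (Fin 2) (Fin 2) →* UnitaryGroup.arch (Fp L) L (IsCMField.complexConj L) (n + n) (hermD L e dV hdV dW hdW))
    (hιψ : ∀ α β γ δ : Matrix (Fin 2) (Fin 2) ℂ, (fromBlocks 1 1 (I • 1) (-(I • 1)) * fromBlocks α β γ δ * ((2 : ℂ)⁻¹ • fromBlocks 1 (-(I • 1)) 1 (I • 1)) : Matrix (Fin 2 ⊕ Fin 2) (Fin 2 ⊕ Fin 2) ℂ)ᴴ * Matrix.J (Fin 2) ℂ + Matrix.J (Fin 2) ℂ * (fromBlocks 1 1 (I • 1) (-(I • 1)) * fromBlocks α β γ δ * ((2 : ℂ)⁻¹ • fromBlocks 1 (-(I • 1)) 1 (I • 1)) : Matrix (Fin 2 ⊕ Fin 2) (Fin 2 ⊕ Fin 2) ℂ) = 0 →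
      ∃ Y' : ↥(uFormGroup (Fin 2) (Fin 2)).lie.toSubmodule, ∀ s : ℝ,
        (UnitaryGroup.archPiEquivCM (n + n) L (hermD L e dV hdV dW hdW)).symm (Pi.mulSingle w (ιw (NormedSpace.exp (s • (fromBlocks 1 1 (I • 1) (-(I • 1)) * fromBlocks α β γ δ * ((2 : ℂ)⁻¹ • fromBlocks 1 (-(I • 1)) 1 (I • 1)) : Matrix (Fin 2 ⊕ Fin 2) (Fin 2 ⊕ Fin 2) ℂ))))) = ψ ((uFormGroup (Fin 2) (Fin 2)).expMem ⟨((s • Y' : ↥(uFormGroup (Fin 2) (Fin 2)).lie.toSubmodule) : Matrix (Fin 2 ⊕ Fin 2) (Fin 2 ⊕ Fin 2) ℂ), (s • Y').2⟩ : UForm (Fin 2) (Fin 2))) :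
    ∀ α β γ δ : Matrix (Fin 2) (Fin 2) ℂ, (fromBlocks 1 1 (I • 1) (-(I • 1)) * fromBlocks α β γ δ * ((2 : ℂ)⁻¹ • fromBlocks 1 (-(I • 1)) 1 (I • 1)) : Matrix (Fin 2 ⊕ Fin 2) (Fin 2 ⊕ Fin 2) ℂ)ᴴ * Matrix.J (Fin 2) ℂ + Matrix.J (Fin 2) ℂ * (fromBlocks 1 1 (I • 1) (-(I • 1)) * fromBlocks α β γ δ * ((2 : ℂ)⁻¹ • fromBlocks 1 (-(I • 1)) 1 (I • 1)) : Matrix (Fin 2 ⊕ Fin 2) (Fin 2 ⊕ Fin 2) ℂ) = 0 →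
      ∃ Y' : ↥(uFormGroup (Fin 2) (Fin 2)).lie.toSubmodule,
        ∀ (y : ∀ w' : {w : InfinitePlace L // w.IsComplex}, UnitaryGroup.archLocal L (n + n) (hermD L e dV hdV dW hdW) w') (u : Matrix (Fin 2) (Fin 2) ℂ), uᴴ * u = 1 → ∀ s : ℝ,
          UnitaryGroup.archToAdelic (Fp L) L (IsCMField.complexConj L) (n + n) (hermD L e dV hdV dW hdW) ((UnitaryGroup.archPiEquivCM (n + n) L (hermD L e dV hdV dW hdW)).symm (Function.update y w (ιw (((2 : ℂ)⁻¹ • fromBlocks (1 + u) (-(I • (1 - u))) (I • (1 - u)) (1 + u) : Matrix (Fin 2 ⊕ Fin 2) (Fin 2 ⊕ Fin 2) ℂ) * NormedSpace.exp (s • (fromBlocks 1 1 (I • 1) (-(I • 1)) * fromBlocks α β γ δ * ((2 : ℂ)⁻¹ • fromBlocks 1 (-(I • 1)) 1 (I • 1)) : Matrix (Fin 2 ⊕ Fin 2) (Fin 2 ⊕ Fin 2) ℂ)))))) =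
            K2LiuArchOneParameterOrbitDefs.archEmb (Fp L) L (IsCMField.complexConj L) (n + n) (hermD L e dV hdV dW hdW) ((UnitaryGroup.archPiEquivCM (n + n) L (hermD L e dV hdV dW hdW)).symm (Function.update y w (ιw ((2 : ℂ)⁻¹ • fromBlocks (1 + u) (-(I • (1 - u))) (I • (1 - u)) (1 + u) : Matrix (Fin 2 ⊕ Fin 2) (Fin 2 ⊕ Fin 2) ℂ)))) *
              K2LiuArchOneParameterOrbitDefs.archEmb (Fp L) L (IsCMField.complexConj L) (n + n) (hermD L e dV hdV dW hdW) (ψ ((uFormGroup (Fin 2) (Fin 2)).expMem ⟨((s • Y' : ↥(uFormGroup (Fin 2) (Fin 2)).lie.toSubmodule) : Matrix (Fin 2 ⊕ Fin 2) (Fin 2 ⊕ Fin 2) ℂ), (s • Y').2⟩ : UForm (Fin 2) (Fin 2))) := by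
  intro α β γ δ hX
  obtain ⟨Y', hY'⟩ := hιψ α β γ δ hX
  refine ⟨Y', fun y u hu s => ?_⟩
  rw [hιmul _ _ (kU_mem_UJ hu) (conjTranspose_exp_mul_J_mul_exp hX s), update_mul_eq_update_mul_mulSingle, map_mul, map_mul, hY' s]
  rfl

end Summit.HodgeConjecture.HodgeConjecture.Cruxes.HLiu418.K2LiuArchTubeCurveReading

end
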